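import Summits.BirchSwinnertonDyer.BirchSwinnertonDyer.Theorems.GenusKolyvaginAtTwoPowDvdShaCardAtTwoRTTwinShaTransfer
import Summits.BirchSwinnertonDyer.BirchSwinnertonDyer.Theorems.GenusKolyvaginAtTwoPowDvdShaCardAtTwoRTGenusIndexRegulator
import HarnessLib

/-!
# Route `GenusKolyvaginAtTwo`, LINE 18 (L_T `PowDvdShaCardAtTwoRT`, stmt-BirchSwinnertonDyer-23242): THE GENUS KERNELS ON THE HABITAT —
# in the crux's own binders (`[ K : ℚ ] = 2`, `Wd = Cd • W^{(d_K)}`, `W(ℚ)` finite of odd order)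

Seat `bsd-line-gk2-p2` g17 (cell `bsd-f1-sign2`), `--supports stmt-BirchSwinnertonDyer-23242` (helper; closes nothing).
THEOREMS ONLY (no definition, no named fact, no `sorry`); BSD is not proved by any of this.

WHAT.  The field-level genus-kernel theorems of this seat (`…RTGenusKernel`, `…RTGenusKernelTwin`, `…RTTwinShaTransfer`) take a
non-trivial `τ ∈ Aut(K/ℚ)`, a square root `θ₀` of `d` in `K` with `τθ₀ = −θ₀`, and «the `τ`-fixed points of `W(K)` are odd torsion».  On
the GK2 habitat these are consequences of `[K : ℚ] = 2` and «`W(ℚ)` finite of odd order» (`rank W(ℚ) = 0`, `W(ℚ)[2] = 0`); this file makes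
the discharge once, so that consumers (the LEAD's assembly of L, gk2-p4's J′) quote the habitat binders only:

* `exists_gal_ne_one_sqrt_discr` — `[K:ℚ] = 2 ⟹ ∃ τ ≠ 1, θ₀ ∉ ℚ` with `θ₀² = d_K`, `τθ₀ = −θ₀`, and `Aut(K/ℚ) = {1, τ}`;
* `exists_incl_eq_of_map_eq` — a point of `W(K)` fixed by `τ` comes from `W(ℚ)` (Galois descent at a quadratic step);
* `forall_fixed_odd_of_finite_odd` — if `W(ℚ)` is finite of odd order, every `τ`-fixed point of `W(K)` is killed by an odd integer;
* **`localRestrictionKer_twin_eq_bot_of_finite_odd`** — `Wd = Cd • W^{(d_K)}`, `W(ℚ)` finite odd ⟹ `ker(H¹(ℚ, Wd) → H¹(K, Wd_K)) = 0`;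
* **`transport_ladder_twin_of_finite_odd`** — hence every rung of L's `Wd`-ladder is carried isomorphically (orders, independence) into
  `Ш(W_K) ≤ H¹(K, W_K)` by `e ∘ res` (`e : H¹(K, Wd_K) ≃ H¹(K, W_K)`, `Ш ↔ Ш`).

References: [Kramer1981] §1, §5 Prop. 8; [SilvermanAEC2009] VIII.§1, X.5 Cor. 5.4; [GrossLMS1991] §1 (habitat).
-/

set_option autoImplicit false
-- the Theorems namespace of this sub repeats the summit name by design (D-0017 nested layout)
set_option linter.dupNamespace false

noncomputable section

open scoped Classical

namespace Summit.BirchSwinnertonDyer.BirchSwinnertonDyer.Theorems.GenusExact.PlusDescent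

open Literature.NumberTheory.EllipticCurves WeierstrassCurve NumberField

section Habitat

variable (W : WeierstrassCurve ℚ) (K : Type) [Field K] [NumberField K]

/-- **`Aut(K/ℚ) = {1, τ}` and `τ√d_K = −√d_K` for a quadratic field.**  `[K : ℚ] = 2` ⟹ there are `τ ∈ Aut(K/ℚ)`, `τ ≠ 1`, and `θ₀ ∈ K ∖ ℚ`
with `θ₀² = d_K` and `τθ₀ = −θ₀`; every automorphism is `1` or `τ`. [folklore] -/
theorem exists_gal_ne_one_sqrt_discr (h2 : Module.finrank ℚ K = 2) :
    ∃ (τ : K ≃ₐ[ℚ] K) (θ₀ : K), τ ≠ 1 ∧ θ₀ ∉ Set.range (algebraMap ℚ K) ∧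
      θ₀ ^ 2 = algebraMap ℚ K (NumberField.discr K : ℚ) ∧ τ θ₀ = -θ₀ ∧ ∀ f : K ≃ₐ[ℚ] K, f = 1 ∨ f = τ := by
  haveI : Algebra.IsQuadraticExtension ℚ K := ⟨h2⟩
  haveI : IsGalois ℚ K := inferInstance
  have hcard : Nat.card (K ≃ₐ[ℚ] K) = 2 := by rw [IsGalois.card_aut_eq_finrank, h2]
  -- a non-trivial automorphism
  obtain ⟨τ, hτ⟩ : ∃ τ : K ≃ₐ[ℚ] K, τ ≠ 1 := by
    by_contra h
    have hsub : Subsingleton (K ≃ₐ[ℚ] K) := ⟨fun a b ↦ by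
      have ha : a = 1 := not_not.mp fun ha ↦ h ⟨a, ha⟩
      have hb : b = 1 := not_not.mp fun hb ↦ h ⟨b, hb⟩
      rw [ha, hb]⟩
    have h1 : Nat.card (K ≃ₐ[ℚ] K) ≤ 1 := Finite.card_le_one_iff_subsingleton.mpr hsub
    omega
  have hall : ∀ f : K ≃ₐ[ℚ] K, f = 1 ∨ f = τ := by
    intro f
    by_contra hf
    rw [not_or] at hf
    have h3 : ({f, τ, 1} : Finset (K ≃ₐ[ℚ] K)).card = 3 := by
      rw [Finset.card_insert_of_notMem, Finset.card_insert_of_notMem, Finset.card_singleton]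
      · simpa only [Finset.mem_singleton] using hτ
      · simp only [Finset.mem_insert, Finset.mem_singleton, not_or]
        exact ⟨hf.2, hf.1⟩
    have hle := Finset.card_le_univ ({f, τ, 1} : Finset (K ≃ₐ[ℚ] K))
    rw [h3, ← Nat.card_eq_fintype_card, hcard] at hle
    omega
  obtain ⟨θ₀, hθ₀Q, hθ₀⟩ := exists_not_mem_range_sq_eq_discr (K := K) h2
  refine ⟨τ, θ₀, hτ, hθ₀Q, hθ₀, ?_, hall⟩
  -- `(τθ₀)² = d_K`, so `τθ₀ = ±θ₀`; `+` would make `θ₀` rational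
  have hsq : (τ θ₀ - θ₀) * (τ θ₀ + θ₀) = 0 := by
    have h := congrArg τ hθ₀
    rw [map_pow, AlgEquiv.commutes] at h
    linear_combination h - hθ₀
  rcases mul_eq_zero.mp hsq with h | h
  · exfalso
    apply hθ₀Q
    rw [IsGalois.mem_range_algebraMap_iff_fixed]
    intro f
    rcases hall f with rfl | rfl
    · rfl
    · exact sub_eq_zero.mp h
  · exact eq_neg_of_add_eq_zero_left h

end Habitat

/-! ### Galois descent of fixed points at a quadratic step (generic base field, so that the point groups carry one instance path) -/

section Descent

variable {F : Type} [Field F] [CharZero F] (W : WeierstrassCurve F) (K : Type) [Field K] [Algebra F K] [FiniteDimensional F K]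

/-- **Galois descent at a quadratic step**: a point of `W(K)` fixed by the non-trivial `τ` is the image of a point of `W(F)`
(its coordinates are fixed by all of `Aut(K/F) = {1, τ}`, hence in `F`). [cite: SilvermanAEC2009, VIII.§1] -/
theorem exists_incl_eq_of_map_eq (h2 : Module.finrank F K = 2) {τ : K ≃ₐ[F] K} (hall : ∀ f : K ≃ₐ[F] K, f = 1 ∨ f = τ)
    (P : (W.baseChange K).toAffine.Point) (hP : Affine.Point.map (τ : K →ₐ[F] K) P = P) :
    ∃ Q : W.toAffine.Point, QuadraticDescent.incl K W Q = P := by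
  haveI : Algebra.IsQuadraticExtension F K := ⟨h2⟩
  haveI : IsGalois F K := inferInstance
  have hfix : ∀ z : K, τ z = z → z ∈ Set.range (algebraMap F K) := fun z hz ↦ by
    rw [IsGalois.mem_range_algebraMap_iff_fixed]
    intro f
    rcases hall f with rfl | rfl
    · rfl
    · exact hz
  rcases P with _ | ⟨x, y, h⟩
  · exact ⟨0, by rw [← Affine.Point.zero_def, map_zero]⟩
  · rw [Affine.Point.map_some] at hP
    simp only [Affine.Point.some.injEq] at hP
    obtain ⟨a, ha⟩ := hfix x hP.1
    obtain ⟨b, hb⟩ := hfix y hP.2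
    exact QuadraticDescent.exists_incl_eq W h ha hb

/-- **`W(F)` finite of odd order ⟹ the `τ`-fixed points of `W(K)` are killed by odd integers** (`[K:F] = 2`; a fixed point comes from
`W(F)`, `exists_incl_eq_of_map_eq`, and `#W(F) • Q = 0`).  GK2 habitat (`F = ℚ`): `rank W(ℚ) = 0`, `W(ℚ)[2] = 0`. [cite: GrossLMS1991, §1] -/
theorem forall_fixed_odd_of_finite_odd (h2 : Module.finrank F K = 2) {τ : K ≃ₐ[F] K} (hall : ∀ f : K ≃ₐ[F] K, f = 1 ∨ f = τ)
    [Finite W.toAffine.Point] (hodd : Odd (Nat.card W.toAffine.Point)) :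
    ∀ P : (W.baseChange K).toAffine.Point, Affine.Point.map (τ : K →ₐ[F] K) P = P → ∃ k : ℕ, Odd k ∧ k • P = 0 := by
  intro P hP
  obtain ⟨Q, rfl⟩ := exists_incl_eq_of_map_eq W K h2 hall P hP
  refine ⟨Nat.card W.toAffine.Point, hodd, ?_⟩
  have h0 : Nat.card W.toAffine.Point • Q = 0 := addOrderOf_dvd_iff_nsmul_eq_zero.mp (addOrderOf_dvd_natCard Q)
  have h := congrArg (QuadraticDescent.incl K W) h0
  rwa [map_nsmul, map_zero] at h

end Descent

section HabitatTwin

variable (W : WeierstrassCurve ℚ) (K : Type) [Field K] [NumberField K]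

/-- **On the habitat the twin has NO class dying over `K`.**  `W/ℚ`, `K` a quadratic field, `Wd = Cd • W^{(d_K)}` (any model of the twist by
the discriminant), `W(ℚ)` finite of ODD order: `ker(H¹(ℚ, Wd) → H¹(K, Wd_K)) = 0` (every anti-invariant point of `Wd(K)` is an
odd-order rational point of `W` read through the twist, hence a norm; `…RTGenusKernelTwin`). [cite: Kramer1981, §1 and §5 Prop. 8] -/
theorem localRestrictionKer_twin_eq_bot_of_finite_odd (h2 : Module.finrank ℚ K = 2) {Wd : WeierstrassCurve ℚ} (Cd : VariableChange ℚ)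
    (hWd : Cd • W.quadraticTwist (NumberField.discr K : ℚ) = Wd) [Finite W.toAffine.Point] (hodd : Odd (Nat.card W.toAffine.Point)) :
    Wd.localRestrictionKer K = ⊥ := by
  obtain ⟨τ, θ₀, hτ, -, hθ₀, hτθ₀, hall⟩ := exists_gal_ne_one_sqrt_discr K h2
  have hd : (NumberField.discr K : ℚ) ≠ 0 := by exact_mod_cast NumberField.discr_ne_zero K
  exact localRestrictionKer_twinModel_eq_bot_of_fixed_odd W K h2 τ hτ hd hθ₀ hτθ₀ Cd hWd
    (forall_fixed_odd_of_finite_odd W K h2 hall hodd)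

/-- **The `Wd`-ladder of L lands in `Ш(W_K)` without loss, on the habitat.**  `W/ℚ`, `K` quadratic, `Wd = Cd • W^{(d_K)}`, `W(ℚ)` finite of odd
order: there is `e : H¹(K, Wd_K) ≃+ H¹(K, W_K)` with `Ш(Wd_K) ↔ Ш(W_K)` such that every family `y_i ∈ H¹(ℚ, Wd)` of order `2^a`, independent
modulo `2^a`, with restrictions in `Ш(Wd_K)`, is carried by `e ∘ res` to a family in `Ш(W_K)` of order `2^a`, independent modulo `2^a` —
the `V`-input of gk2-p4's `pow_two_mul_dvd_natCard_sha_of_disjoint_ladders` (J′). [cite: SilvermanAEC2009, X.5 Cor. 5.4]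
[cite: McCallumLMS1991, §5 Thm. 5.4] -/
theorem transport_ladder_twin_of_finite_odd (h2 : Module.finrank ℚ K = 2) {Wd : WeierstrassCurve ℚ} (Cd : VariableChange ℚ)
    (hWd : Cd • W.quadraticTwist (NumberField.discr K : ℚ) = Wd) [Finite W.toAffine.Point] (hodd : Odd (Nat.card W.toAffine.Point)) :
    ∃ e : (Wd.baseChange K).galH1 ≃+ (W.baseChange K).galH1,
      (∀ c : (Wd.baseChange K).galH1, c ∈ (Wd.baseChange K).sha ↔ e c ∈ (W.baseChange K).sha) ∧
      ∀ {n a : ℕ} (y : Fin n → Wd.galH1), (∀ i, resBaseChange Wd K (y i) ∈ (Wd.baseChange K).sha) →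
        (∀ i, addOrderOf (y i) = 2 ^ a) → (∀ c : Fin n → ℤ, ∑ i, c i • y i = 0 → ∀ i, ((2 ^ a : ℕ) : ℤ) ∣ c i) →
        (∀ i, e (resBaseChange Wd K (y i)) ∈ (W.baseChange K).sha) ∧
        (∀ i, addOrderOf (e (resBaseChange Wd K (y i))) = 2 ^ a) ∧
        ∀ c : Fin n → ℤ, ∑ i, c i • e (resBaseChange Wd K (y i)) = 0 → ∀ i, ((2 ^ a : ℕ) : ℤ) ∣ c i := by
  obtain ⟨τ, θ₀, hτ, -, hθ₀, hτθ₀, hall⟩ := exists_gal_ne_one_sqrt_discr K h2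
  have hd : (NumberField.discr K : ℚ) ≠ 0 := by exact_mod_cast NumberField.discr_ne_zero K
  exact transport_ladder_twin W K hd hθ₀ Cd hWd (localRestrictionKer_twin_eq_bot_of_finite_odd W K h2 Cd hWd hodd)

end HabitatTwin

end Summit.BirchSwinnertonDyer.BirchSwinnertonDyer.Theorems.GenusExact.PlusDescent

end
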